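import Literature.AlgebraicTopology.CharacteristicClasses.ComplexVectorBundle
import Literature.AlgebraicTopology.CharacteristicClasses.ProjectivizationCharts
import Mathlib.Topology.Algebra.Module.FiniteDimension
import HarnessLib

/-!
# The tautological line bundle over a projective space `ℙ K V`

Topic `Literature/AlgebraicTopology/CharacteristicClasses`. Over the projective space `ℙ K V`
of a finite-dimensional normed space `V` (the quotient topology of the tree's `ProjectiveSpace.lean`,
charts of `ProjectivizationCharts.lean`) the
**tautological (canonical) line bundle** has fibre over the point `ℓ = [v]` the line
`ℓ ⊆ V` itself: Husemoller, *Fibre Bundles*, Ch. 17 §2 — the canonical line bundle `λ_ξ` on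
`P(ξ)`, "a point in the total space `E(λ_ξ)` of `λ_ξ` over `L` is a pair `(L, x)` … `x ∈ L`",
whose restriction to a fibre "is isomorphic to the canonical line bundle on `FP^{n-1}`"
(Prop. 2.2); Milnor–Stasheff §14 (`γ¹(ℂⁿ)`); Hirzebruch §4.2 (the bundle `η_n⁻¹` associated to
`ℂⁿ⁺¹ ∖ 0 → P_n(ℂ)`, trivial over the charts `Uᵢ = {zᵢ ≠ 0}`).

We build it as an honest Mathlib vector bundle with fibres the submodules
`tautFiber K V ℓ = ℓ.submodule` (`Projectivization.submodule`), through Mathlib's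
`VectorPrebundle` mechanism: for every continuous functional `φ : V →L[K] K` the chart
`U_φ = {[v] | φ v ≠ 0}` (`chartDomain`) carries the pretrivialisation
`(ℓ, w) ↦ (ℓ, φ w)` with inverse `(ℓ, t) ↦ (ℓ, t • v_φ(ℓ))`, `v_φ(ℓ) = (φ v)⁻¹ v` the normalised
representative (`affineRep`); the transition from `U_φ` to `U_ψ` is multiplication by the
continuous function `ψ(v_φ(ℓ)) = ψ(v)/φ(v)` (Hirzebruch's cocycle `zⱼ/zᵢ`).

## Contents (everything proved; no named facts)

* `tautFiber K V ℓ` (an `abbrev` for `↥ℓ.submodule`), `apply_smul_affineRep`, `bijective_dual_restrict`;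
* `tautPretrivialization K V φ` and its linearity; `chartFunctional ℓ` (a continuous functional
  not vanishing on `ℓ`, finite dimension);
* `tautPrebundle K V : VectorPrebundle K K (tautFiber K V)` and the resulting instances
  `TopologicalSpace (TotalSpace K (tautFiber K V))`, `FiberBundle`, `VectorBundle K K`;
* `projTautologicalLineBundle V : ComplexVectorBundle (ℙ ℂ V)` — the bundled complex line
  bundle (`rank = 1`), the object whose Euler/first Chern class generates `H*(ℂP^{n-1})`.

## Design notes

* Fibres are the actual lines (subtypes of `V`), so that the complement of the zero section is
  literally `{(ℓ, w) | w ≠ 0} ≅ V ∖ {0}` (next file) — Husemoller's description of `E(λ_ξ)`.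
* Hypotheses: `K` a complete nontrivially normed field and `V` finite-dimensional normed (every
  functional is continuous, lines are closed and homeomorphic to `K`); the `ComplexVectorBundle`
  packaging is `K = ℂ`.
* Mathlib searches: no tautological/canonical bundle, no topology on `Projectivization`
  (`tautological`, `Projectivization` + `Bundle`: nothing); the tree's `tautologicalLineBundle` is
  the `ℂP¹ = OnePoint ℂ` clutching model of `ComplexVectorBundle.lean`, a different object
  (comparison not made here). Nothing restated.

## References

* [HusemollerFibreBundles1994] D. Husemoller, *Fibre Bundles*, 3rd ed., GTM 20 (1994), Ch. 17 §2
  (Def. 2.1, the canonical line bundle `λ_ξ`, Prop. 2.2).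
* [Hirzebruch1966] F. Hirzebruch, *Topological Methods in Algebraic Geometry*, 3rd ed. (1966),
  §4.2 (charts `Uᵢ`, cocycle `zⱼ/zᵢ`, the bundle `η_n⁻¹`).
* [MilnorStasheffAMS76] J. Milnor, J. Stasheff, *Characteristic Classes* (1974), §14 (`γ¹`).
-/

noncomputable section

open Function Set Filter Bundle Topology
open scoped LinearAlgebra.Projectivization

universe u v

namespace Literature.AlgebraicTopology.CharacteristicClasses

section Algebra

variable (K : Type u) (V : Type v) [Field K] [AddCommGroup V] [Module K V]

/-- **The fibre of the tautological line bundle** over `ℓ ∈ ℙ K V`: the line `ℓ ⊆ V` itself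
(Husemoller Ch. 17 §2: the points of `E(λ_ξ)` over `L` are the pairs `(L, x)`, `x ∈ L`). An
`abbrev` for Mathlib's `↥ℓ.submodule`, so all module/topology instances are inherited (for any
vector space `V`, e.g. a fibre of a vector bundle). [cite: HusemollerFibreBundles1994, Ch. 17 §2 (λ_ξ)] -/
abbrev tautFiber (ℓ : ℙ K V) : Type v := ↥(Projectivization.submodule ℓ)

variable {K V}

/-- A vector of the line `ℓ ∈ U_φ` is `φ(w)` times the normalised representative. [cite: Hirzebruch1966, §4.2] -/
theorem apply_smul_affineRep (φ : Module.Dual K V) {p : ℙ K V} (hp : p ∈ chartDomain φ)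
    (w : tautFiber K V p) : φ (w : V) • affineRep φ p = w := by
  have hw : (w : V) ∈ K ∙ affineRep φ p := by
    rw [← submodule_eq_span_affineRep φ hp]
    exact w.2
  obtain ⟨c, hc⟩ := Submodule.mem_span_singleton.1 hw
  rw [← hc, map_smul, smul_eq_mul, apply_affineRep φ hp, mul_one]

/-- `φ` restricts to a linear BIJECTION of the line `ℓ ∈ U_φ` onto `K` (inverse `t ↦ t • v_φ(ℓ)`).
[cite: Hirzebruch1966, §4.2] -/
theorem bijective_dual_restrict (φ : Module.Dual K V) {ℓ : ℙ K V} (hℓ : ℓ ∈ chartDomain φ) :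
    Bijective fun w : tautFiber K V ℓ ↦ φ (w : V) := by
  constructor
  · intro w w' h
    apply Subtype.ext
    rw [← apply_smul_affineRep φ hℓ w, ← apply_smul_affineRep φ hℓ w']
    exact congrArg (· • _) h
  · intro t
    refine ⟨⟨t • affineRep φ ℓ, Submodule.smul_mem _ _ (affineRep_mem_submodule _ _)⟩, ?_⟩
    change φ (t • affineRep φ ℓ) = t
    rw [map_smul, smul_eq_mul, apply_affineRep φ hℓ, mul_one]

end Algebra

section General

variable (K : Type u) (V : Type v) [NontriviallyNormedField K] [NormedAddCommGroup V]
  [NormedSpace K V]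

/-- **The pretrivialisation of the tautological bundle over the chart `U_φ`** of a continuous
functional `φ`: `(ℓ, w) ↦ (ℓ, φ w)`, with inverse `(ℓ, t) ↦ (ℓ, t • v_φ(ℓ))` (Hirzebruch §4.2:
`η_n⁻¹` is trivial over `Uᵢ`, a vector of the line being recorded by its `i`-th coordinate).
[cite: Hirzebruch1966, §4.2] -/
def tautPretrivialization (φ : V →L[K] K) : Pretrivialization K (π K (tautFiber K V)) where
  toFun p := (p.1, φ (p.2 : V))
  invFun q := ⟨q.1, ⟨q.2 • affineRep (φ : Module.Dual K V) q.1,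
    Submodule.smul_mem _ _ (affineRep_mem_submodule _ _)⟩⟩
  source := π K (tautFiber K V) ⁻¹' chartDomain (φ : Module.Dual K V)
  target := chartDomain (φ : Module.Dual K V) ×ˢ univ
  map_source' p hp := ⟨hp, mem_univ _⟩
  map_target' q hq := hq.1
  left_inv' := by
    rintro ⟨ℓ, w⟩ hℓ
    change (⟨ℓ, ⟨φ (w : V) • affineRep (φ : Module.Dual K V) ℓ, _⟩⟩ : TotalSpace K (tautFiber K V)) =
      ⟨ℓ, w⟩
    congr 1
    exact Subtype.ext (apply_smul_affineRep (φ : Module.Dual K V) hℓ w)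
  right_inv' := by
    rintro ⟨ℓ, t⟩ ⟨hℓ, -⟩
    change (ℓ, φ (t • affineRep (φ : Module.Dual K V) ℓ)) = (ℓ, t)
    rw [map_smul, smul_eq_mul]
    erw [apply_affineRep (φ : Module.Dual K V) hℓ]
    rw [mul_one]
  open_target := (isOpen_chartDomain _ φ.continuous).prod isOpen_univ
  baseSet := chartDomain (φ : Module.Dual K V)
  open_baseSet := isOpen_chartDomain _ φ.continuous
  source_eq := rfl
  target_eq := rfl
  proj_toFun _ _ := rfl

/-- The pretrivialisation reads off the `φ`-coordinate. [cite: Hirzebruch1966, §4.2] -/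
@[simp]
theorem tautPretrivialization_apply (φ : V →L[K] K) (p : TotalSpace K (tautFiber K V)) :
    tautPretrivialization K V φ p = (p.1, φ (p.2 : V)) := rfl

/-- Its base set is the chart `U_φ`. [cite: Hirzebruch1966, §4.2] -/
@[simp]
theorem tautPretrivialization_baseSet (φ : V →L[K] K) :
    (tautPretrivialization K V φ).baseSet = chartDomain (φ : Module.Dual K V) := rfl

/-- Its local inverse is `(ℓ, t) ↦ (ℓ, t • v_φ(ℓ))`. [cite: Hirzebruch1966, §4.2] -/
theorem tautPretrivialization_symm_apply (φ : V →L[K] K) (q : ℙ K V × K) :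
    (tautPretrivialization K V φ).toPartialEquiv.symm q =
      ⟨q.1, ⟨q.2 • affineRep (φ : Module.Dual K V) q.1,
        Submodule.smul_mem _ _ (affineRep_mem_submodule _ _)⟩⟩ := rfl

/-- The pretrivialisation is fibrewise linear (`w ↦ φ w`). [folklore] -/
instance tautPretrivialization_isLinear (φ : V →L[K] K) :
    (tautPretrivialization K V φ).IsLinear K where
  linear _ _ :=
    { map_add := fun w w' ↦ by simp
      map_smul := fun c w ↦ by simp }

end General

section FiniteDimensional

variable (K : Type u) (V : Type v) [NontriviallyNormedField K] [CompleteSpace K]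
  [NormedAddCommGroup V] [NormedSpace K V] [FiniteDimensional K V]

/-- A continuous functional not vanishing on the line `ℓ` (a chart `U_φ ∋ ℓ`; in finite dimension
every functional is continuous). [cite: Hirzebruch1966, §4.2] -/
def chartFunctional (ℓ : ℙ K V) : V →L[K] K :=
  LinearMap.toContinuousLinearMap (Classical.choose (exists_mem_chartDomain ℓ))

/-- `ℓ ∈ U_{φ_ℓ}`. [cite: Hirzebruch1966, §4.2] -/
theorem mem_chartDomain_chartFunctional (ℓ : ℙ K V) :
    ℓ ∈ chartDomain ((chartFunctional K V ℓ : V →L[K] K) : Module.Dual K V) :=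
  Classical.choose_spec (exists_mem_chartDomain ℓ)

variable {K V} in
/-- The linear homeomorphism `ℓ ≃L K`, `w ↦ φ w`, for `ℓ ∈ U_φ` (finite dimension makes both
directions continuous). [cite: Hirzebruch1966, §4.2] -/
def fiberEquivOfMemChart (φ : V →L[K] K) {ℓ : ℙ K V}
    (hℓ : ℓ ∈ chartDomain ((φ : V →L[K] K) : Module.Dual K V)) : tautFiber K V ℓ ≃L[K] K :=
  (LinearEquiv.ofBijective ((φ : V →ₗ[K] K).domRestrict (Projectivization.submodule ℓ))
    (bijective_dual_restrict ((φ : V →L[K] K) : Module.Dual K V) hℓ)).toContinuousLinearEquiv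

variable {K V} in
omit [FiniteDimensional K V] in
/-- The linear homeomorphism is `w ↦ φ w`. [folklore] -/
@[simp]
theorem fiberEquivOfMemChart_apply (φ : V →L[K] K) {ℓ : ℙ K V}
    (hℓ : ℓ ∈ chartDomain ((φ : V →L[K] K) : Module.Dual K V)) (w : tautFiber K V ℓ) :
    fiberEquivOfMemChart φ hℓ w = φ (w : V) := rfl

/-- **The tautological line bundle over `ℙ K V` as a Mathlib `VectorPrebundle`**: atlas the
pretrivialisations over all charts `U_φ`, transition `U_φ → U_ψ` multiplication by the continuous
function `ℓ ↦ ψ(v_φ(ℓ))` (`= ψ(v)/φ(v)`, Hirzebruch's cocycle `zⱼ/zᵢ`), and fibre topology the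
subspace topology of the line, which `φ` identifies with `K`.
[cite: Hirzebruch1966, §4.2] [cite: HusemollerFibreBundles1994, Ch. 17 §2 (λ_ξ)] -/
def tautPrebundle : VectorPrebundle K K (tautFiber K V) where
  pretrivializationAtlas := range (tautPretrivialization K V)
  pretrivialization_linear' := by
    rintro _ ⟨φ, rfl⟩
    infer_instance
  pretrivializationAt ℓ := tautPretrivialization K V (chartFunctional K V ℓ)
  mem_base_pretrivializationAt := mem_chartDomain_chartFunctional K V
  pretrivialization_mem_atlas ℓ := ⟨_, rfl⟩
  exists_coordChange := by
    rintro _ ⟨φ, rfl⟩ _ ⟨ψ, rfl⟩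
    refine ⟨fun ℓ ↦ ψ (affineRep (φ : Module.Dual K V) ℓ) • ContinuousLinearMap.id K K, ?_, ?_⟩
    · have hψ : ContinuousOn (fun ℓ ↦ ψ (affineRep (φ : Module.Dual K V) ℓ))
          ((tautPretrivialization K V φ).baseSet ∩ (tautPretrivialization K V ψ).baseSet) :=
        ψ.continuous.comp_continuousOn
          ((continuousOn_affineRep (φ : Module.Dual K V) φ.continuous).mono inter_subset_left)
      exact hψ.smul (continuousOn_const (c := ContinuousLinearMap.id K K))
    · rintro ℓ ⟨hφ, -⟩ t
      rw [(tautPretrivialization K V φ).mk_symm hφ t, tautPretrivialization_symm_apply,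
        tautPretrivialization_apply]
      change ψ (affineRep (φ : Module.Dual K V) ℓ) * t = ψ (t • affineRep (φ : Module.Dual K V) ℓ)
      rw [map_smul, smul_eq_mul, mul_comm]
  totalSpaceMk_isInducing ℓ := by
    set e := fiberEquivOfMemChart (chartFunctional K V ℓ) (mem_chartDomain_chartFunctional K V ℓ)
      with he
    have h1 : IsInducing e := by simpa using e.toHomeomorph.isInducing
    have h : IsInducing fun w : tautFiber K V ℓ ↦ (ℓ, e w) := isInducing_const_prod.mpr h1
    exact h

/-- The topology on the total space `E(λ) = {(ℓ, w) | w ∈ ℓ}` of the tautological line bundle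
(from the prebundle; a new instance, nothing in Mathlib/the tree topologises this sigma type).
[cite: HusemollerFibreBundles1994, Ch. 17 §2 (λ_ξ)] -/
instance instTopologicalSpaceTautTotalSpace :
    TopologicalSpace (TotalSpace K (tautFiber K V)) :=
  (tautPrebundle K V).totalSpaceTopology

/-- The tautological line bundle is a fibre bundle with fibre `K`.
[cite: HusemollerFibreBundles1994, Ch. 17 §2 (λ_ξ)] -/
instance instFiberBundleTaut : FiberBundle K (tautFiber K V) :=
  (tautPrebundle K V).toFiberBundle

/-- The tautological line bundle is a `K`-vector bundle.
[cite: HusemollerFibreBundles1994, Ch. 17 §2 (λ_ξ)] -/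
instance instVectorBundleTaut : VectorBundle K K (tautFiber K V) :=
  (tautPrebundle K V).toVectorBundle

/-- The projection `(ℓ, w) ↦ ℓ` of the tautological bundle is continuous. [folklore] -/
theorem continuous_tautProj : Continuous (π K (tautFiber K V)) :=
  FiberBundle.continuous_proj K (tautFiber K V)

/-- The inclusion of a fibre `ℓ ↪ E(λ)`, `w ↦ (ℓ, w)`, is continuous. [folklore] -/
theorem continuous_tautTotalSpaceMk (ℓ : ℙ K V) :
    Continuous (TotalSpace.mk ℓ : tautFiber K V ℓ → TotalSpace K (tautFiber K V)) :=
  FiberBundle.continuous_totalSpaceMk K (tautFiber K V) ℓ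

end FiniteDimensional

/-! ### The complex tautological line bundle `γ¹(V)` over `ℙ ℂ V` -/

section Complex

variable (V : Type) [NormedAddCommGroup V] [NormedSpace ℂ V] [FiniteDimensional ℂ V]

/-- **The tautological line bundle `γ¹ → ℙ(V)` of a finite-dimensional complex normed space `V`**
as a bundled `ComplexVectorBundle` (model fibre `ℂ`, fibre over `ℓ` the complex line `ℓ ⊆ V`):
Husemoller's canonical line bundle on `ℂP^{n-1}` (Ch. 17 §2, Prop. 2.2), Milnor–Stasheff's
`γ¹(ℂⁿ)`, Hirzebruch's `η⁻¹`. [cite: HusemollerFibreBundles1994, Ch. 17 §2 Prop. 2.2]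
[cite: Hirzebruch1966, §4.2] -/
def projTautologicalLineBundle : ComplexVectorBundle.{0, 0} (ℙ ℂ V) where
  F := ℂ
  E := tautFiber ℂ V

/-- `γ¹(V)` is a line bundle. [folklore] -/
@[simp]
theorem rank_projTautologicalLineBundle : (projTautologicalLineBundle V).rank = 1 :=
  Module.finrank_self ℂ

end Complex

end Literature.AlgebraicTopology.CharacteristicClasses
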